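import Summits.CriticalPhenomena.PercolationContinuityZ3.Theorems.Transplant.HexShadowSide
import HarnessLib

/-!
# HEXAGONAL SHADOWS XII — the two inputs of DST's Lemma 4 in hexagonal geometry: the local bound `P[E_m(x, x)] ≤ c < 1` (closed neighbourhoods of
# a column, uniformly in the scale and the position by the lifted translations) and `P[E_m(0, m)] → 1` (the square-root trick over the twelve
# half-sides of the hexagon: six rotations, one flip)

builds on p205010 (kernel theorem, internal audit signed; external expert review pending) — NOT used in this file.
Lane `prim-bschramm`, seat `prim-bschramm-p2` (gen 32; class C1b; memo `HOME/bschramm/P2-LATTICES.md` §115); helper file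
(`--supports stmt-CriticalPhenomena-4575 --as helper`).  Slab original: `Literature/…/SlabCriticality` §"Lemma4Tools" (`allClosed`, `real_allClosed_pos`,
`real_sideEvent_point_le`, `sqrt_trick_two`, `tendsto_real_sideEvent_zero`).
* §1 square-root tricks for `P_p` on a general graph (`sqrt_trick_two_graph`);
* §2 closed neighbourhoods `edgesClosed F` (all edges inside `F` closed): cylinder, measurable, positive probability for `p < 1`, transport along a lifted
  symmetry; the UNIFORM constant `closedConst Φ p = P_p[all edges over hexBall c (2·period) closed]` bounds `P_p[all edges over hexBall q 1 closed]` from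
  below for EVERY `q ∈ 𝕋` (reduce `q − c` modulo `period` and translate);
* §3 the local bound: an open path from `\overline{X}` to the column over a point `q ∉ X` uses an open edge over `hexBall q 1` (the shadow is
  `triNorm`-1-Lipschitz), whence `P[X ⟷^B {q}] ≤ 1 − closedConst` and **`real_sideEvent_point_le`**: `P[E_m(x, x)] ≤ 1 − closedConst` (`u < 2m`);
* §4 **`tendsto_real_sideEvent_upper`**: `P[hexBall c v_m ⟷^{hexBall c 2m} hexSphere c 2m] → 1 ⇒ P[E_m(0, m)] → 1`, with
  `P[E_m(0,m)] ≥ 1 − (1 − P[· ⟷ hexSphere])^{1/12}` (DST: exponent `1/8` for the square).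
[cite: DuminilCopinSidoraviciusTassion2016, §2.1 Lemma 4 (proof)] [cite: GrimmettPercolation1999, (11.14) and §1.6 p. 16]
-/

noncomputable section

namespace Summit.CriticalPhenomena.PercolationContinuityZ3.Theorems.Transplant

open MeasureTheory Literature.Probability.Percolation Literature.Probability.LatticeModels SimpleGraph Filter
open scoped Classical Topology

/-! ## §1 Square-root tricks on a general graph -/

/-- **Square-root trick, two-event form** (DST eq. (3) with `m = 2`): for increasing measurable `A, B` and `C ⊆ A ∪ B`,
`max(P[A], P[B]) ≥ 1 − (1 − P[C])^{1/2}`. [cite: DuminilCopinSidoraviciusTassion2016, §2.1 eq. (3)] -/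
theorem sqrt_trick_two_graph {V : Type} (G : SimpleGraph V) (p : unitInterval) {A B C : Set (BondConfig V)}
    (hA : IsUpperSet A) (hB : IsUpperSet B) (hAm : MeasurableSet A) (hBm : MeasurableSet B) (hC : C ⊆ A ∪ B) :
    1 - (1 - (bondPercolation G p).real C) ^ ((2 : ℝ)⁻¹) ≤ max ((bondPercolation G p).real A) ((bondPercolation G p).real B) := by
  set P := bondPercolation G p with hP
  obtain ⟨i, hi⟩ := sqrt_trick_holds G p (ι := Bool) (fun b => if b then A else B) (fun b => by cases b <;> simpa) (fun b => by cases b <;> simpa)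
  have hU : (⋃ b : Bool, (if b then A else B)) = A ∪ B := by
    ext ω; simp [or_comm]
  rw [hU] at hi
  simp only [Fintype.card_bool, Nat.cast_ofNat] at hi
  have hmono : 1 - (1 - P.real C) ^ ((2 : ℝ)⁻¹) ≤ 1 - (1 - P.real (A ∪ B)) ^ ((2 : ℝ)⁻¹) := by
    have h1 : P.real C ≤ P.real (A ∪ B) := measureReal_mono hC
    have h2 : P.real (A ∪ B) ≤ 1 := measureReal_le_one
    have := Real.rpow_le_rpow (by linarith) (by linarith : 1 - P.real (A ∪ B) ≤ 1 - P.real C) (by norm_num : (0 : ℝ) ≤ 2⁻¹)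
    linarith
  refine hmono.trans ?_
  cases i
  · exact hi.trans (le_max_right _ _)
  · exact hi.trans (le_max_left _ _)

/-- **Square-root trick for a finite family of equiprobable increasing events** covering `C`: each has probability `≥ 1 − (1 − P[C])^{1/#ι}`.
[cite: DuminilCopinSidoraviciusTassion2016, §2.1 eq. (3)] -/
theorem sqrt_trick_equiprobable {V : Type} (G : SimpleGraph V) (p : unitInterval) {ι : Type} [Fintype ι] [Nonempty ι]
    (A : ι → Set (BondConfig V)) (hA : ∀ i, IsUpperSet (A i)) (hAm : ∀ i, MeasurableSet (A i)) {C : Set (BondConfig V)} (hC : C ⊆ ⋃ i, A i)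
    (heq : ∀ i j, (bondPercolation G p).real (A i) = (bondPercolation G p).real (A j)) (i : ι) :
    1 - (1 - (bondPercolation G p).real C) ^ ((Fintype.card ι : ℝ)⁻¹) ≤ (bondPercolation G p).real (A i) := by
  set P := bondPercolation G p with hP
  obtain ⟨j, hj⟩ := sqrt_trick_holds G p A hA hAm
  rw [heq i j]
  refine le_trans ?_ hj
  have h1 : P.real C ≤ P.real (⋃ i, A i) := measureReal_mono hC
  have h2 : P.real (⋃ i, A i) ≤ 1 := measureReal_le_one
  have hr : (0 : ℝ) ≤ (Fintype.card ι : ℝ)⁻¹ := by positivity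
  have := Real.rpow_le_rpow (by linarith) (by linarith : 1 - P.real (⋃ i, A i) ≤ 1 - P.real C) hr
  linarith

/-! ## §2 Closed neighbourhoods -/

/-- The event that every edge with both endpoints in `F` is closed. [folklore] -/
def edgesClosed {V : Type} (F : Set V) : Set (BondConfig V) := {ω | ∀ e ∈ Set.sym2 F, e ∉ ω}

/-- `edgesClosed` is antitone in the vertex set. [folklore] -/
theorem edgesClosed_anti {V : Type} {F F' : Set V} (h : F ⊆ F') : edgesClosed F' ⊆ edgesClosed F :=
  fun _ hω e he => hω e (by rw [Set.mem_sym2_iff_subset] at he ⊢; exact he.trans h)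

/-- For finite `F`, `edgesClosed F` is the cylinder "all pairs of `F` absent". [folklore] -/
theorem edgesClosed_eq_localCylinder {V : Type} {F : Set V} (hF : F.Finite) :
    edgesClosed F = localCylinder (↑(finite_sym2 hF).toFinset) (∅ : Set (Sym2 V)) := by
  ext ω
  simp [edgesClosed, localCylinder]

/-- `edgesClosed F` is measurable for finite `F`. [folklore] -/
theorem measurableSet_edgesClosed {V : Type} {F : Set V} (hF : F.Finite) : MeasurableSet (edgesClosed F) := by
  rw [edgesClosed_eq_localCylinder hF]
  exact measurableSet_localCylinder (Finset.finite_toSet _).countable _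

/-- **For `p < 1`, all edges of a fixed finite region are closed with positive probability.** [folklore] -/
theorem real_edgesClosed_pos {V : Type} (G : SimpleGraph V) (p : unitInterval) (hp : (p : ℝ) < 1) {F : Set V} (hF : F.Finite) :
    0 < (bondPercolation G p).real (edgesClosed F) := by
  rw [edgesClosed_eq_localCylinder hF, show bondPercolation G p = ProbabilityTheory.setBernoulli G.edgeSet p from rfl,
    Russo.setBernoulli_real_localCylinder]
  refine Finset.prod_pos fun e _ => ?_
  simp only [Russo.weight, Set.mem_empty_iff_false, if_false]
  split_ifs
  · linarith
  · norm_num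

/-- Transport of `edgesClosed` along an automorphism: `{ω | α·ω ∈ edgesClosed (α '' F)} = edgesClosed F`. [folklore] -/
theorem preimage_relabel_edgesClosed {V : Type} {G : SimpleGraph V} (α : G ≃g G) (F : Set V) :
    BondConfig.relabel (sym2Equiv α.toEquiv) ⁻¹' edgesClosed (α '' F) = edgesClosed F := by
  ext ω
  simp only [Set.mem_preimage, edgesClosed, Set.mem_setOf_eq]
  constructor
  · intro h e he heω
    have hmem : sym2Equiv α.toEquiv e ∈ Set.sym2 (α '' F) := by
      rw [Set.mem_sym2_iff_subset] at he ⊢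
      intro v hv
      rw [SetLike.mem_coe, sym2Equiv_apply, Sym2.mem_map] at hv
      obtain ⟨w, hw, rfl⟩ := hv
      exact Set.mem_image_of_mem _ (he hw)
    have := h _ hmem
    rw [BondConfig.mem_relabel_iff, Equiv.symm_apply_apply] at this
    exact this heω
  · intro h e he heω
    rw [BondConfig.mem_relabel_iff] at heω
    refine h _ ?_ heω
    rw [Set.mem_sym2_iff_subset] at he ⊢
    intro v hv
    rw [SetLike.mem_coe, sym2Equiv_symm, sym2Equiv_apply, Sym2.mem_map] at hv
    obtain ⟨w, hw, rfl⟩ := hv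
    have : w ∈ α '' F := he hw
    obtain ⟨w', hw', rfl⟩ := this
    convert hw' using 2
    exact Equiv.symm_apply_apply _ _

namespace HexShadow

variable {V : Type} {G : SimpleGraph V} (Φ : HexShadow G)

/-- The triangle inequality for `triNorm`, distance form (private copy). [folklore] -/
private theorem triNorm_sub_le₁₂ (u v w : Site 2) : triNorm (u - w) ≤ triNorm (u - v) + triNorm (v - w) := by
  simp only [triNorm, Pi.sub_apply, max_le_iff]
  have l0 := (abs_le_triNorm (u - v)).1; have l1 := (abs_le_triNorm (u - v)).2
  have l2 : |(u - v) 0 + (u - v) 1| ≤ triNorm (u - v) := (le_max_right _ _).trans (le_max_right _ _)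
  have m0 := (abs_le_triNorm (v - w)).1; have m1 := (abs_le_triNorm (v - w)).2
  have m2 : |(v - w) 0 + (v - w) 1| ≤ triNorm (v - w) := (le_max_right _ _).trans (le_max_right _ _)
  simp only [triNorm, Pi.sub_apply] at l0 l1 l2 m0 m1 m2 ⊢
  rw [abs_le] at l0 l1 l2 m0 m1 m2
  refine ⟨abs_le.2 ⟨?_, ?_⟩, abs_le.2 ⟨?_, ?_⟩, abs_le.2 ⟨?_, ?_⟩⟩ <;> linarith

/-- **Translation invariance of closed neighbourhoods**: all edges over `hexBall (z + period•t) r` are closed with the probability of all edges over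
`hexBall z r` being closed. [folklore] -/
theorem real_edgesClosed_shift [Countable V] (p : unitInterval) (z t : Site 2) (r : ℕ) :
    (bondPercolation G p).real (edgesClosed (Φ.lift (hexBall (z + (Φ.period : ℤ) • t) r))) =
      (bondPercolation G p).real (edgesClosed (Φ.lift (hexBall z r))) := by
  obtain ⟨γ, hγ⟩ := Φ.shift t
  set d : Site 2 := (Φ.period : ℤ) • t with hd
  have hγg : ∀ w, Φ.sh (γ w) = Equiv.addRight d (Φ.sh w) := fun w => by rw [Equiv.coe_addRight, hγ]
  have e1 : Φ.lift (hexBall (z + d) r) = γ '' Φ.lift (hexBall z r) := by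
    rw [← image_addRight_hexBall d z r, Φ.image_lift γ (Equiv.addRight d) hγg]
  rw [e1, ← bondPercolation_real_preimage_relabel_iso γ p (edgesClosed (γ '' Φ.lift (hexBall z r))), preimage_relabel_edgesClosed]

/-- **The uniform closed-neighbourhood constant** `P_p[all edges over hexBall c (2·period) closed]`.
[cite: DuminilCopinSidoraviciusTassion2016, Lemma 4 (proof: "smaller than some constant c < 1 uniformly in n")] -/
def closedConst [Countable V] (p : unitInterval) : ℝ :=
  (bondPercolation G p).real (edgesClosed (Φ.lift (hexBall Φ.centre (2 * Φ.period))))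

/-- The uniform constant is positive for `p < 1`. [folklore] -/
theorem closedConst_pos [Countable V] (p : unitInterval) (hp : (p : ℝ) < 1) : 0 < Φ.closedConst p :=
  real_edgesClosed_pos G p hp (Φ.lift_finite (hexBall_finite _ _))

/-- **Every unit hexagon lies in a translate of `hexBall c (2·period)` by a symmetry translation** (reduce `q − c` modulo `period`). [folklore] -/
theorem exists_hexBall_one_subset (q : Site 2) : ∃ t : Site 2, hexBall q 1 ⊆ hexBall (Φ.centre + (Φ.period : ℤ) • t) (2 * Φ.period) := by
  set P : ℤ := (Φ.period : ℤ) with hPdef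
  have hP : 0 < P := by rw [hPdef]; exact_mod_cast Φ.period_pos
  set v : Site 2 := q - Φ.centre with hv
  refine ⟨![v 0 / P, v 1 / P], fun w hw => ?_⟩
  rw [mem_hexBall] at hw ⊢
  have hr0 : 0 ≤ v 0 % P := Int.emod_nonneg _ hP.ne'
  have hr0' : v 0 % P < P := Int.emod_lt_of_pos _ hP
  have hr1 : 0 ≤ v 1 % P := Int.emod_nonneg _ hP.ne'
  have hr1' : v 1 % P < P := Int.emod_lt_of_pos _ hP
  have hd0 : v 0 % P + P * (v 0 / P) = v 0 := Int.emod_add_mul_ediv _ _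
  have hd1 : v 1 % P + P * (v 1 / P) = v 1 := Int.emod_add_mul_ediv _ _
  -- `w − (c + P•t) = (w − q) + r`, `r = v − P•t`
  have hwq := hw
  simp only [triNorm, Pi.sub_apply] at hwq
  push_cast at hwq
  rw [max_le_iff, max_le_iff, abs_le, abs_le, abs_le] at hwq
  simp only [triNorm, Pi.sub_apply, Pi.add_apply, Pi.smul_apply, smul_eq_mul, Matrix.cons_val_zero, Matrix.cons_val_one, max_le_iff]
  have e0 : q 0 = Φ.centre 0 + v 0 := by simp [hv]
  have e1 : q 1 = Φ.centre 1 + v 1 := by simp [hv]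
  rw [e0, e1] at hwq
  push_cast
  obtain ⟨⟨a1, a2⟩, ⟨b1, b2⟩, ab1, ab2⟩ := hwq
  refine ⟨abs_le.2 ⟨?_, ?_⟩, abs_le.2 ⟨?_, ?_⟩, abs_le.2 ⟨?_, ?_⟩⟩ <;> linarith

/-- **Uniform lower bound**: `closedConst ≤ P_p[all edges over hexBall q 1 closed]` for every `q`. [folklore] -/
theorem closedConst_le [Countable V] (p : unitInterval) (q : Site 2) :
    Φ.closedConst p ≤ (bondPercolation G p).real (edgesClosed (Φ.lift (hexBall q 1))) := by
  obtain ⟨t, ht⟩ := Φ.exists_hexBall_one_subset q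
  unfold closedConst
  rw [← Φ.real_edgesClosed_shift p Φ.centre t (2 * Φ.period)]
  exact measureReal_mono (edgesClosed_anti (Φ.lift_mono ht))

/-! ## §3 The local bound -/

/-- **An open path from `\\overline{X}` to the column over `q ∉ X` uses an open edge over `hexBall q 1`** (its last edge enters the column from a
vertex whose shadow is a `𝕋`-neighbour of `q`, the shadow being `triNorm`-1-Lipschitz). [cite: DuminilCopinSidoraviciusTassion2016, Lemma 4 (proof)] -/
theorem not_mem_edgesClosed_of_conn_point {ω : BondConfig V} (hω : ω ⊆ G.edgeSet) {B X : Set (Site 2)} {q : Site 2} (hq : q ∉ X)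
    (h : ω ∈ Φ.conn B X {q}) : ω ∉ edgesClosed (Φ.lift (hexBall q 1)) := by
  obtain ⟨a, ha, b, hb, hab⟩ := h
  rw [mem_lift, Set.mem_singleton_iff] at hb
  have hba : PathIn (openGraph ω) (Φ.lift B) b a := (mem_openConnIn_iff_pathIn.1 hab).symm
  intro hcl
  rcases hba.exit_or (R := Φ.lift {q}) (by rw [mem_lift]; exact hb) with h | ⟨x, y, hx, hy, -, hadj, -⟩
  · have haq : a ∈ Φ.lift {q} := h.right_mem.1
    rw [mem_lift, Set.mem_singleton_iff] at haq
    rw [mem_lift, haq] at ha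
    exact hq ha
  · have hopen : s(x, y) ∈ ω := ((openGraph_adj ω x y).1 hadj).1
    have hlat : G.Adj x y := (SimpleGraph.mem_edgeSet _).1 (hω hopen)
    rw [mem_lift, Set.mem_singleton_iff] at hx
    refine hcl s(x, y) ?_ hopen
    rw [Set.mk_mem_sym2_iff]
    constructor
    · rw [mem_lift, mem_hexBall, hx, sub_self, triNorm_zero]; norm_num
    · rw [mem_lift, mem_hexBall, Nat.cast_one]
      have := Φ.lip hlat
      rw [hx] at this
      have e : triNorm (Φ.sh y - q) = triNorm (q - Φ.sh y) := by
        rw [show Φ.sh y - q = -(q - Φ.sh y) by abel]; simp only [triNorm, Pi.neg_apply, ← neg_add, abs_neg]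
      rw [e]; exact this

/-- **`P[X ⟷^B {q}] ≤ 1 − closedConst`** for `q ∉ X`. [cite: DuminilCopinSidoraviciusTassion2016, Lemma 4 (proof)] -/
theorem real_conn_point_le [Countable V] (p : unitInterval) {B X : Set (Site 2)} {q : Site 2} (hq : q ∉ X) :
    (bondPercolation G p).real (Φ.conn B X {q}) ≤ 1 - Φ.closedConst p := by
  set P := bondPercolation G p with hP
  have hle : P.real (Φ.conn B X {q}) ≤ P.real (edgesClosed (Φ.lift (hexBall q 1)))ᶜ := by
    refine ENNReal.toReal_mono (measure_ne_top _ _) (measure_mono_ae ?_)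
    filter_upwards [ProbabilityTheory.setBernoulli_ae_subset (u := G.edgeSet) (p := p)] with ω hω hE
    exact Φ.not_mem_edgesClosed_of_conn_point hω hq hE
  have hcompl : P.real (edgesClosed (Φ.lift (hexBall q 1)))ᶜ = 1 - P.real (edgesClosed (Φ.lift (hexBall q 1))) :=
    probReal_compl_eq_one_sub (measurableSet_edgesClosed (Φ.lift_finite (hexBall_finite q 1)))
  have := Φ.closedConst_le p q
  linarith

/-- A side point is at `triNorm`-distance at least `2m` from the centre (whatever the interval). [folklore] -/
theorem two_mul_le_triNorm_of_mem_hexSide {z : Site 2} {m : ℕ} {α β : ℤ} {w : Site 2} (hw : w ∈ hexSide z m α β) : 2 * (m : ℤ) ≤ triNorm (w - z) := by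
  obtain ⟨h0, -, -⟩ := hw
  have : |(w - z) 0| = 2 * m := by
    rw [Pi.sub_apply, h0, show z 0 + 2 * (m : ℤ) - z 0 = 2 * m by ring, abs_of_nonneg (by positivity)]
  rw [← this]
  exact (abs_le_triNorm (w - z)).1

/-- The point side segment: `hexSide z m x x = {z + (2m, x − m)}`. [folklore] -/
theorem hexSide_self (z : Site 2) (m : ℕ) (x : ℤ) : hexSide z m x x = {z + ![2 * (m : ℤ), x - m]} := by
  ext w
  simp only [mem_hexSide, Set.mem_singleton_iff]
  constructor
  · rintro ⟨h0, h1, h2⟩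
    ext j; fin_cases j
    · simp [h0]
    · simp; omega
  · rintro rfl
    simp only [Pi.add_apply, Matrix.cons_val_zero, Matrix.cons_val_one, true_and]
    omega

/-- **THE LOCAL BOUND `P[E_m(x, x)] ≤ 1 − closedConst`** (`u < 2m`: the inner hexagon does not reach the side).
[cite: DuminilCopinSidoraviciusTassion2016, Lemma 4 (proof: "P[ℰ_n(0,0)] is smaller than some constant c < 1 uniformly in n")] -/
theorem real_sideEvent_point_le [Countable V] (p : unitInterval) (z : Site 2) {m u : ℕ} (hu : u < 2 * m) (x : ℤ) :
    (bondPercolation G p).real (Φ.sideEvent z m u x x) ≤ 1 - Φ.closedConst p := by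
  unfold sideEvent
  rw [hexSide_self]
  refine Φ.real_conn_point_le p ?_
  rw [mem_hexBall, add_sub_cancel_left]
  simp only [triNorm, Matrix.cons_val_zero, Matrix.cons_val_one, not_le]
  refine lt_of_lt_of_le ?_ (le_max_left _ _)
  rw [abs_of_nonneg (by positivity)]
  exact_mod_cast hu

/-! ## §4 `P[E_m(0, m)] → 1` by the square-root trick over the twelve half-sides -/

/-- **The full side is likely**: `P[hexBall c v ⟷^{hexBall c 2m} Σ] ≥ 1 − (1 − P[hexBall c v ⟷^{hexBall c 2m} hexSphere c 2m])^{1/6}` — the six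
rotated copies of the side `Σ = hexSide c m (−m) m` cover the sphere and are equiprobable targets (lifted rotations).
[cite: DuminilCopinSidoraviciusTassion2016, Lemma 4 (proof: "using the symmetries of the box")] -/
theorem real_sideEvent_full_ge [Countable V] (p : unitInterval) (m v : ℕ) :
    1 - (1 - (bondPercolation G p).real (Φ.conn (hexBall Φ.centre (2 * m)) (hexBall Φ.centre v) (hexSphere Φ.centre (2 * m)))) ^ ((6 : ℝ)⁻¹) ≤
      (bondPercolation G p).real (Φ.sideEvent Φ.centre m v (-(m : ℤ)) m) := by
  set c := Φ.centre with hc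
  set A : Fin 6 → Set (BondConfig V) := fun j => Φ.conn (hexBall c (2 * m)) (hexBall c v) (((hexRotAt c) ^ (j : ℕ)) '' hexSide c m (-(m : ℤ)) m)
    with hA
  have hcov : Φ.conn (hexBall c (2 * m)) (hexBall c v) (hexSphere c (2 * m)) ⊆ ⋃ j, A j :=
    (Φ.conn_mono subset_rfl subset_rfl (hexSphere_subset_iUnion_side c m)).trans (Φ.conn_iUnion_right_subset _ _ _)
  have heq : ∀ i j : Fin 6, (bondPercolation G p).real (A i) = (bondPercolation G p).real (A j) := fun i j => by
    simp only [hA, hc, Φ.real_conn_rotPow]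
  have key := sqrt_trick_equiprobable G p A (fun j => isUpperSet_openCrossing _ _ _) (fun j => Φ.measurableSet_conn_hexBall c (2 * m) _ _) hcov heq 0
  simp only [Fintype.card_fin, Nat.cast_ofNat, hA, Fin.val_zero, pow_zero, Equiv.Perm.coe_one, Set.image_id] at key
  exact key

/-- **`P[E_m(0, m)] → 1`**: if `P[hexBall c v_m ⟷^{hexBall c 2m} hexSphere c 2m] → 1` then the UPPER HALF-SIDE is reached with probability `→ 1`
(`E_m(−m, m) ⊆ E_m(−m, 0) ∪ E_m(0, m)`, the two halves being exchanged by the lifted side flip; altogether exponent `1/12`).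
[cite: DuminilCopinSidoraviciusTassion2016, Lemma 4 (proof: "P[ℰ_n(0,n)] ≥ 1 − (1 − P[S_n ⟷ ∂B_n])^{1/8}")] -/
theorem tendsto_real_sideEvent_upper [Countable V] (p : unitInterval) (v : ℕ → ℕ)
    (hD : Tendsto (fun m => (bondPercolation G p).real (Φ.conn (hexBall Φ.centre (2 * m)) (hexBall Φ.centre (v m)) (hexSphere Φ.centre (2 * m))))
      atTop (𝓝 1)) :
    Tendsto (fun m => (bondPercolation G p).real (Φ.sideEvent Φ.centre m (v m) 0 m)) atTop (𝓝 1) := by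
  set c := Φ.centre with hc
  set P := bondPercolation G p with hP
  -- step 1: the full side
  have h1 : Tendsto (fun m => P.real (Φ.sideEvent c m (v m) (-(m : ℤ)) m)) atTop (𝓝 1) :=
    tendsto_one_of_sqrt_trick (r := (6 : ℝ)⁻¹) (by norm_num) hD (fun m => measureReal_le_one)
      (Filter.Eventually.of_forall fun m => Φ.real_sideEvent_full_ge p m (v m))
  -- step 2: the upper half, by the flip
  refine tendsto_one_of_sqrt_trick (r := (2 : ℝ)⁻¹) (by norm_num) h1 (fun m => measureReal_le_one) (Filter.Eventually.of_forall fun m => ?_)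
  have hcov : Φ.sideEvent c m (v m) (-(m : ℤ)) m ⊆ Φ.sideEvent c m (v m) 0 m ∪ Φ.sideEvent c m (v m) (-(m : ℤ)) 0 := by
    intro ω hω
    rcases Φ.sideEvent_subset_union c m (v m) (-(m : ℤ)) 0 m hω with h | h
    · exact Or.inr h
    · exact Or.inl (Φ.sideEvent_mono c m (v m) (by norm_num) le_rfl h)
  have hsym : P.real (Φ.sideEvent c m (v m) (-(m : ℤ)) 0) = P.real (Φ.sideEvent c m (v m) 0 m) := by
    have := Φ.real_sideEvent_flip p m (v m) 0 m
    rw [neg_zero] at this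
    exact this
  have := sqrt_trick_two_graph G p (Φ.isUpperSet_sideEvent c m (v m) 0 m) (Φ.isUpperSet_sideEvent c m (v m) (-(m : ℤ)) 0)
    (Φ.measurableSet_sideEvent c m (v m) 0 m) (Φ.measurableSet_sideEvent c m (v m) (-(m : ℤ)) 0) hcov
  rwa [hsym, max_self] at this

end HexShadow

end Summit.CriticalPhenomena.PercolationContinuityZ3.Theorems.Transplant

end
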